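import Literature.MathematicalPhysics.QuantumFieldTheory.Balaban1983to89.WilsonLoopsNotCompleteSO8
import Literature.MathematicalPhysics.QuantumFieldTheory.Balaban1983to89.InfiniteVolumeSufficientXXIII
import HarnessLib

/-!
# LATTICE FORM OF THE `SO(8)` CENSUS NEGATIVE: on `ℤ^{d+2}`, NO family of class-function loop observables — Wilson
# loops in ALL representations, with products — spans the gauge-invariant cylinder observables of an `SO(8)` lattice
# gauge field (module XIX's density schema fails for `SO(8)` in every representation at once)

statement-level skeleton of published theorems with citation tags; proofs where landed; nothing here is a claim about
the Yang–Mills mass gap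

Cell `lit-balaban`, unit p24 gen 20, file 4 of the own-lane free target (G.5-34(d); no SKELETON row).  Module XIX's
density schema `SpansGaugeInvariantCylinders d 𝒲` ([Levy2004] Thm 3.1 transported to cylinder observables of `ℤ^d`)
is decided in the tree for the Wilson-loop products of the NATURAL representation: false for `SO(2m)` (p348765, the
Pfaffian plaquette observable), and by module XXI PART C true whenever `TraceWordsSeparateOrbits ρ` holds.  File 3 of
this unit (`WilsonLoopsNotCompleteSO8`) proved `¬ TraceWordsSeparateOrbits ρ` for EVERY representation `ρ` of
`SO(8)`.  THIS FILE draws the lattice consequence in its strongest form: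

* §1 three generic lattice lemmas the tree lacked: the holonomy of a walk IS the value of a word (the word of its
  darts) at the configuration (`walkHolonomy_eq_wordVal`); **gauge covariance of walk holonomies**
  `hol_w(U^g) = g(x) hol_w(U) g(y)⁻¹` for a walk from `x` to `y` (`walkHolonomy_gaugeTransformZd`; the tree had the
  plaquette case `plaquetteHolonomyZd_gaugeTransformZd` only); straight walks along an unloaded direction have
  trivial holonomy;
* §2 the class `classLoopProducts d G` of ALL finite products of observables `U ↦ f(hol_ℓ(U))`, `ℓ` any based closed
  walk, `f : G → ℝ` ANY conjugation-invariant function (all characters of all finite-dimensional representations, real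
  and imaginary parts, and every other class function, continuous or not) — it contains `wilsonLoopProducts ρ d` for
  every `ρ` (`wilsonLoopProducts_subset_classLoopProducts`);
* §3 the two test configurations: the finite family `s ⊂ U(3)` of file 3 (`exists_finset_not_simultaneous_conj`) is
  loaded on the edges `e_k = ((2k+1)·𝐞₁, direction 0)` through `V = Ad` resp. `W = Q·Ad·Q` (`cfgOf`); by §1 and file 3's
  `exists_wordVal_conj` EVERY loop holonomy of the `W`-configuration is `SO(8)`-conjugate to that of the
  `V`-configuration, so every element of `classLoopProducts` takes the same value on the two (`eq_on_cfg`);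
* §4 a gauge-invariant continuous bounded cylinder observable SEPARATING them: with the based rectangles
  `ℓ_k = ∂([0,1]𝐞₀ × [0,2k+1]𝐞₁)` at the origin (`loopAt`, holonomy `= V_k` resp. `W_k`, `walkHolonomy_loopAt`),
  `F(U) = min(1, inf_{y ∈ SO(8)} Σ_k ‖hol_{ℓ_k}(U)·y − y·V_k‖²_F)` (`sepObs`) — an observable of the shape of
  [Levy2004] Remark 2.4 («Instead of considering one loop, we can consider several loops» based at the same point,
  and a function of their holonomies «invariant by diagonal adjunction»): gauge invariant because all `ℓ_k` are based at the origin and the Frobenius norm is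
  `O(8)`-invariant, continuous as an infimum over a compact group, `F = 0` at the `V`-configuration and `F ≠ 0` at
  the `W`-configuration (the infimum is attained; `= 0` would be a simultaneous conjugator, excluded by file 3);
* §5 module XXIII's criterion `not_spansGaugeInvariantCylinders_of_pointFunctional` with the two-point functional
  `W ↦ W(U_V) − W(U_W)` gives the HEADLINE `not_spansGaugeInvariantCylinders_classLoopProducts`:
  **for every `d`, `¬ SpansGaugeInvariantCylinders (d+2) (classLoopProducts (d+2) SO(8))`**, hence
  `¬ SpansGaugeInvariantCylinders (d+2) 𝒲` for every sub-class `𝒲` (all Wilson loops of any set of representations,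
  `…_of_subset`), in particular `¬ SpansGaugeInvariantCylinders (d+2) (wilsonLoopProducts ρ (d+2))` for EVERY
  representation `ρ : SO(8) →* M_N(ℂ)` (`…_wilsonLoopProducts_specialOrthogonalGroup_eight`; p348765 was the natural
  `ρ`).  Contrast: for `SU(N)` module XXIII refutes every FINITE family of single-loop functions but (Sengupta) the
  natural Wilson-loop products DO span; for `SO(8)` not even the full class algebra of all loops does.

HONEST SCOPE.  `SO(8)` only (the mechanism needs an even-dimensional irreducible orthogonal representation all of
whose elements fix a vector; `SO(4)`, `SO(6)` undecided here).  Lattice `ℤ^{d+2}` (two directions are used); nothing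
about torus states, the Wilson action or the infinite-volume question — the statement is about the observable algebra
only (as in modules XX/XXII/XXIII).  The separating observable is an infimum over `SO(8)`, not a polynomial (a
separating SPIN NETWORK exists by [Levy2004] Thm 4.1 — Baez: spin networks are dense in `C(G^r)^G` for every compact
`G` — but none is constructed here).  What this says about print: [Levy2004] p.3 announces that its method «allows us
to add even orthogonal groups to the list»; for `SO(8)` the Wilson loops of all representations are NOT complete
(file 3 on the bouquets `L_r`, this file on `ℤ^{d+2}`); the located sentence is p.10 «The theorem for SO(n) follows
from that for O(n) just because» `ρ(ℂSO(n)) = ρ(ℂO(n))`, which fails for even `n` (HOME/GAPS.md G-p24-g20-1).  Not a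
claim about any audited manuscript of the Bałaban programme; NOT summit progress.

## References

* [Levy2004] T. Lévy, *Wilson loops in the light of spin networks*, J. Geom. Phys. 52 (2004) 382–397: §2 p.4 (Wilson
  loops `W_{α,l} = χ_α ∘ h_l`; «the action of φ ∈ G^V on G^E conjugates h_l by φ_{s(e_1)}^{-1}»; Remark 2.4), Thm 3.1
  p.5 (the `SO(n)` clause, refuted at `n = 8` on every graph `L_r` by file 3 and on `ℤ^{d+2}` here), Thm 4.1 p.6,
  p.3 and p.10 (the two sentences quoted above).
* [Sikora2017] A. S. Sikora, *SO(2n,ℂ)-character varieties are not varieties of characters*, J. Algebra 478 (2017)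
  195–214, §2 (the mechanism).
* [Sengupta1994] A. Sengupta, *Gauge invariant functions of connections*, Proc. AMS 121 (1994) 897–905, Thm 2 p.900.
-/

noncomputable section

open Matrix SimpleGraph

namespace Literature.MathematicalPhysics.QuantumFieldTheory.Balaban1983to89.ClassLoopObservablesNotDenseSO8

open Literature.MathematicalPhysics.QuantumLattice
open Literature.Probability.LatticeModels (zdGraph)
open Balaban1983to89.Missing (SpansGaugeInvariantCylinders)
open WilsonLoopsNotCompleteSO8 (SO8 U3 famV famW exists_wordVal_conj exists_finset_not_simultaneous_conj)

/-! ## §1 Generic lattice lemmas: holonomy is a word; gauge covariance; unloaded straight walks -/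

section Generic

variable {d : ℕ} {G : Type*} [Group G]

/-- **THE HOLONOMY OF A WALK IS A WORD**: `hol_w(U) = w̃(U)` where `w̃` is the list of oriented edges under the darts
of `w` (tree `dartStep`) and the configuration `U : edges → G` is read as a family indexed by the edges (module XX's
`wordVal`). [cite: Levy2004, §2 p.4 (h_l(g) = g_{e_n} ⋯ g_{e_1}; Prop. 3.4's words)] -/
theorem walkHolonomy_eq_wordVal (U : LGConfig d G) {x y : (Fin d → ℤ)} (w : (zdGraph d).Walk x y) :
    walkHolonomy U w = wordVal (w.darts.map dartStep) U := by
  simp only [walkHolonomy, wordVal, List.map_map]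
  rfl

omit [Group G] in
/-- Two unit steps in the same direction do not cancel. [folklore] -/
private theorem add_single_add_single_ne (i : Fin d) (x : (Fin d → ℤ)) :
    x + Pi.single i (1 : ℤ) + Pi.single i 1 ≠ x := by
  intro h
  have h1 := congrFun h i
  simp only [Pi.add_apply, Pi.single_eq_same] at h1
  omega

/-- **Gauge covariance of a dart holonomy**: `(U^g)_e = g(x) U_e g(y)⁻¹` for a dart `e : x → y`.
[cite: Levy2004, §2 p.4 («the action of φ ∈ G^V on G^E conjugates h_l by φ_{s(e_1)}^{-1}»)] -/
theorem dartHolonomy_gaugeTransformZd (g : (Fin d → ℤ) → G) (U : LGConfig d G) (e : (zdGraph d).Dart) :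
    dartHolonomy (gaugeTransformZd g U) e = g e.fst * dartHolonomy U e * (g e.snd)⁻¹ := by
  rcases dartDir_spec e with h | h
  · have hs : dartStep e = ((e.fst, dartDir e), true) := by rw [dartStep, if_pos h]
    simp only [dartHolonomy, hs, gaugeTransformZd, ← h, if_true]
  · have hne : ¬ e.snd = e.fst + Pi.single (dartDir e) 1 := fun h' => by
      rw [h] at h'
      exact add_single_add_single_ne _ _ h'.symm
    have hs : dartStep e = ((e.snd, dartDir e), false) := by rw [dartStep, if_neg hne]
    simp only [dartHolonomy, hs, gaugeTransformZd, ← h, Bool.false_eq_true, if_false, _root_.mul_inv_rev, inv_inv,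
      mul_assoc]

/-- **GAUGE COVARIANCE OF WALK HOLONOMIES**: `hol_w(U^g) = g(x) · hol_w(U) · g(y)⁻¹` for a walk `w` from `x` to `y`;
in particular the holonomy of a CLOSED walk based at `x` is conjugated by `g(x)` (the tree had the plaquette case
`plaquetteHolonomyZd_gaugeTransformZd`). [cite: Levy2004, §2 p.4 («the action of φ ∈ G^V on G^E conjugates h_l by φ_{s(e_1)}^{-1}»)] -/
theorem walkHolonomy_gaugeTransformZd (g : (Fin d → ℤ) → G) (U : LGConfig d G) {x y : (Fin d → ℤ)}
    (w : (zdGraph d).Walk x y) : walkHolonomy (gaugeTransformZd g U) w = g x * walkHolonomy U w * (g y)⁻¹ := by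
  induction w with
  | nil => simp
  | cons h w ih =>
    rw [walkHolonomy_cons, walkHolonomy_cons, ih, dartHolonomy_gaugeTransformZd]
    group

/-- A class observable of a based loop is gauge invariant. [cite: Levy2004, §2 p.4 («W_{α,l} = χ_α ∘ h_l … is well-defined»)] -/
theorem isZdGaugeInvariant_comp_walkHolonomy {α : Type*} {f : G → α} (hf : ∀ a b : G, f (b * a * b⁻¹) = f a)
    {x : (Fin d → ℤ)} (w : (zdGraph d).Walk x x) : IsZdGaugeInvariant fun U : LGConfig d G => f (walkHolonomy U w) := by
  intro g U
  simp only [walkHolonomy_gaugeTransformZd, hf]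

/-- A straight walk in a direction `i` along which the configuration is trivial has trivial holonomy. [folklore] -/
private theorem walkHolonomy_lineWalk_eq_one {U : LGConfig d G} {i : Fin d} (hU : ∀ z : (Fin d → ℤ), U (z, i) = 1) :
    ∀ (n : ℕ) (x : (Fin d → ℤ)), walkHolonomy U (lineWalk i n x) = 1
  | 0, x => by simp [lineWalk]
  | n + 1, x => by
    rw [lineWalk, walkHolonomy_cons, walkHolonomy_copy, dartHolonomy_add_single, hU, one_mul,
      walkHolonomy_lineWalk_eq_one hU n]

/-- The holonomy of a rectangle is the product of its four sides. [folklore] -/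
private theorem walkHolonomy_rectWalk (U : LGConfig d G) (x : (Fin d → ℤ)) (i j : Fin d) (R T : ℕ) :
    walkHolonomy U (rectWalk x i j R T) =
      walkHolonomy U (lineWalk i R x) * walkHolonomy U (lineWalk j T (x + Pi.single i (R : ℤ))) *
        (walkHolonomy U (lineWalk i R (x + Pi.single j (T : ℤ))))⁻¹ * (walkHolonomy U (lineWalk j T x))⁻¹ := by
  simp only [rectWalk, walkHolonomy_append, walkHolonomy_copy, walkHolonomy_reverse, mul_assoc]

end Generic

/-! ## §2 The class of all products of class-function loop observables -/

section ClassObservables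

variable {d : ℕ} {G : Type*} [Group G]

/-- **ALL FINITE PRODUCTS OF CLASS-FUNCTION LOOP OBSERVABLES** `U ↦ ∏_k f_k(hol_{ℓ_k}(U))` — `ℓ_k` based closed walks
of `ℤ^d`, `f_k : G → ℝ` ANY conjugation-invariant functions (`1` for the empty product).  Contains Lévy's class of
Wilson-loop products in every representation. [cite: Levy2004, §2 p.4 and Thm 3.1 p.5 (the algebra generated by the Wilson loops of all representations)] -/
def classLoopProducts (d : ℕ) (G : Type*) [Group G] : Set (LGConfig d G → ℝ) :=
  {W | ∃ l : List ((Σ x : (Fin d → ℤ), (zdGraph d).Walk x x) × (G → ℝ)),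
    (∀ p ∈ l, ∀ a b : G, p.2 (b * a * b⁻¹) = p.2 a) ∧ W = fun U => (l.map fun p => p.2 (walkHolonomy U p.1.2)).prod}

/-- Lévy's class in the representation `ρ` is contained in the class of all class-loop products
(`Re/Im tr ρ` are class functions: the tree's `tracePart_conj`). [cite: Levy2004, Thm 3.1 p.5] -/
theorem wilsonLoopProducts_subset_classLoopProducts {N : ℕ} (ρ : G →* Matrix (Fin N) (Fin N) ℂ) :
    wilsonLoopProducts ρ d ⊆ classLoopProducts d G := by
  rintro W ⟨l, rfl⟩
  refine ⟨l.map fun p => (p.1, tracePart ρ p.2), fun q hq a b => ?_, ?_⟩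
  · obtain ⟨p, _, rfl⟩ := List.mem_map.1 hq
    exact tracePart_conj ρ p.2 b a
  · funext U
    simp only [loopProduct, List.map_map, Function.comp_def]
    exact congrArg List.prod (List.map_congr_left fun p _ => by rcases p with ⟨ℓ, b⟩; exact loopFactor_eq_tracePart ρ ℓ b U)

/-- If every loop holonomy of `U'` is conjugate to that of `U`, every class-loop product agrees on `U` and `U'`. [cite: Levy2004, §2 p.4] -/
theorem eq_of_mem_classLoopProducts {W : LGConfig d G → ℝ} (hW : W ∈ classLoopProducts d G) {U U' : LGConfig d G}
    (hconj : ∀ (x : (Fin d → ℤ)) (w : (zdGraph d).Walk x x), ∃ y : G, walkHolonomy U' w = y * walkHolonomy U w * y⁻¹) :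
    W U = W U' := by
  obtain ⟨l, hl, rfl⟩ := hW
  exact congrArg List.prod (List.map_congr_left fun p hp => by
    obtain ⟨y, hy⟩ := hconj p.1.1 p.1.2
    rw [hy, hl p hp])

end ClassObservables

/-! ## §3 The two test configurations of `SO(8)` on `ℤ^{d+2}` -/

section Configurations

variable (d : ℕ)

/-- The `k`-th LOADED EDGE: from `(2k+1)·𝐞₁` in direction `0`. [folklore] -/
def loadedEdge (k : ℕ) : ZdEdge (d + 2) := (Pi.single 1 ((2 * k + 1 : ℕ) : ℤ), 0)

/-- The `k`-th BASED LOOP at the origin: up `2k+1` steps along `𝐞₁`, one step along `𝐞₀` (the loaded edge `e_k`),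
down, back (the boundary of `[0,1]𝐞₀ × [0,2k+1]𝐞₁`). [folklore] -/
def loopAt (k : ℕ) : (zdGraph (d + 2)).Walk (0 : (Fin (d + 2) → ℤ)) 0 := rectWalk 0 1 0 (2 * k + 1) 1

variable {d}

/-- The loaded edges are pairwise distinct. [folklore] -/
private theorem loadedEdge_injective : Function.Injective (loadedEdge d) := by
  intro k l h
  have h1 := congrArg (fun e : ZdEdge (d + 2) => e.1 1) h
  simp only [loadedEdge, Pi.single_eq_same] at h1
  omega

/-- `(1 : Fin (d+2)) ≠ 0`. [folklore] -/
private theorem one_ne_zero_fin : (1 : Fin (d + 2)) ≠ 0 := by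
  simp

variable {r : ℕ}

/-- The edge labelling by `U(3)`: `u_k` on the loaded edge `e_k` (`k < r`), `1` elsewhere. [folklore] -/
def edgeLabel (u : Fin r → U3) : ZdEdge (d + 2) → U3 := Function.extend (fun k : Fin r => loadedEdge d k) u 1

/-- On the loaded edge `e_k` the label is `u_k`. [folklore] -/
private theorem edgeLabel_loadedEdge (u : Fin r → U3) (k : Fin r) : edgeLabel u (loadedEdge d k) = u k :=
  (loadedEdge_injective.comp Fin.val_injective).extend_apply _ _ k

/-- Off direction `0` the label is `1`. [folklore] -/
private theorem edgeLabel_of_snd_ne (u : Fin r → U3) {e : ZdEdge (d + 2)} (he : e.2 ≠ 0) : edgeLabel u e = 1 := by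
  rw [edgeLabel, Function.extend_apply']
  · rfl
  · rintro ⟨k, hk⟩
    exact he (by rw [← hk]; rfl)

/-- The edge at the origin in direction `0` is unloaded. [folklore] -/
private theorem edgeLabel_origin (u : Fin r → U3) : edgeLabel u ((0 : (Fin (d + 2) → ℤ)), (0 : Fin (d + 2))) = 1 := by
  rw [edgeLabel, Function.extend_apply']
  · rfl
  · rintro ⟨k, hk⟩
    have h1 : ((2 * (k : ℕ) + 1 : ℕ) : ℤ) = 0 := by
      simpa [loadedEdge] using congrArg (fun e : ZdEdge (d + 2) => e.1 1) hk
    omega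

/-- **THE TEST CONFIGURATION** attached to `φ : U(3) → SO(8)` (`φ = V = Ad` or `φ = W = Q·Ad·Q`) and the labels `u`:
`φ(u_k)` on the loaded edge `e_k`, `φ(1) = 1` elsewhere. [cite: Sikora2017, §2 (the families ρ, ρ' = MρM⁻¹)] -/
def cfgOf (φ : U3 → SO8) (u : Fin r → U3) : LGConfig (d + 2) SO8 := φ ∘ edgeLabel u

/-- `V(1) = 1`. [folklore] -/
private theorem famV_one : famV 1 = 1 := map_one _

/-- `W(1) = 1`. [folklore] -/
private theorem famW_one : famW 1 = 1 := by
  change WilsonLoopsNotCompleteSO8.conjQ (Literature.LinearAlgebra.Matrix.AdjointSU3Orthogonal.adSO8 1) = 1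
  rw [map_one, map_one]

/-- **Holonomy of the based loop `ℓ_k` at the test configuration = `φ(u_k)`** (the three other sides are unloaded).
[folklore] -/
private theorem walkHolonomy_loopAt {φ : U3 → SO8} (hφ : φ 1 = 1) (u : Fin r → U3) (k : Fin r) :
    walkHolonomy (cfgOf φ u) (loopAt d k) = φ (u k) := by
  have h1 : ∀ z : (Fin (d + 2) → ℤ), cfgOf (d := d) φ u (z, 1) = 1 := fun z => by
    simp only [cfgOf, Function.comp_apply, edgeLabel_of_snd_ne u (e := (z, 1)) one_ne_zero_fin, hφ]
  rw [loopAt, walkHolonomy_rectWalk, walkHolonomy_lineWalk_eq_one h1, walkHolonomy_lineWalk_eq_one h1,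
    walkHolonomy_lineWalk_one, walkHolonomy_lineWalk_one, zero_add]
  simp only [cfgOf, Function.comp_apply, inv_one, one_mul, mul_one, edgeLabel_origin, hφ]
  rw [← loadedEdge, edgeLabel_loadedEdge]

/-- **EVERY LOOP HOLONOMY OF THE `W`-CONFIGURATION IS `SO(8)`-CONJUGATE TO THAT OF THE `V`-CONFIGURATION** (holonomy =
word of the darts, §1; file 3's `exists_wordVal_conj`). [cite: Sikora2017, §2; Levy2004, Prop 3.4 (hypothesis)] -/
theorem exists_walkHolonomy_cfg_conj (u : Fin r → U3) {x y : (Fin (d + 2) → ℤ)} (w : (zdGraph (d + 2)).Walk x y) :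
    ∃ g : SO8, walkHolonomy (cfgOf famW u) w = g * walkHolonomy (cfgOf famV u) w * g⁻¹ := by
  rw [walkHolonomy_eq_wordVal, walkHolonomy_eq_wordVal]
  exact exists_wordVal_conj (edgeLabel u) _

/-- Hence every class-loop product takes the SAME value on the two test configurations. [cite: Sikora2017, Thm «undisting» («undistinguishable by the generalized trace functions»)] -/
theorem eq_on_cfg {W : LGConfig (d + 2) SO8 → ℝ} (hW : W ∈ classLoopProducts (d + 2) SO8) (u : Fin r → U3) :
    W (cfgOf famV u) = W (cfgOf famW u) :=
  eq_of_mem_classLoopProducts hW fun _ w => exists_walkHolonomy_cfg_conj u w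

end Configurations

/-! ## §4 The separating gauge-invariant cylinder observable -/

section Separating

variable {d r : ℕ}

/-- Squared Frobenius norm `Σ_{ij} M_{ij}²` of a real `8 × 8` matrix. [folklore] -/
def frob (M : Matrix (Fin 8) (Fin 8) ℝ) : ℝ := ∑ i, ∑ j, M i j ^ 2

/-- `0 ≤ ‖M‖²_F`. [folklore] -/
private theorem frob_nonneg (M : Matrix (Fin 8) (Fin 8) ℝ) : 0 ≤ frob M :=
  Finset.sum_nonneg fun _ _ => Finset.sum_nonneg fun _ _ => sq_nonneg _

/-- `‖M‖²_F = 0 → M = 0`. [folklore] -/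
private theorem eq_zero_of_frob_eq_zero {M : Matrix (Fin 8) (Fin 8) ℝ} (h : frob M = 0) : M = 0 := by
  ext i j
  have hi := (Finset.sum_eq_zero_iff_of_nonneg fun i _ => Finset.sum_nonneg fun j _ => sq_nonneg (M i j)).1 h i
    (Finset.mem_univ _)
  have hij := (Finset.sum_eq_zero_iff_of_nonneg fun j _ => sq_nonneg (M i j)).1 hi j (Finset.mem_univ _)
  exact pow_eq_zero_iff (n := 2) two_ne_zero |>.1 hij

/-- `‖M‖²_F = tr(MᵀM)`. [folklore] -/
private theorem frob_eq_trace (M : Matrix (Fin 8) (Fin 8) ℝ) : frob M = (Mᵀ * M).trace := by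
  simp only [frob, Matrix.trace, Matrix.diag_apply, Matrix.mul_apply, Matrix.transpose_apply, pow_two]
  rw [Finset.sum_comm]

/-- The Frobenius norm is invariant under left multiplication by an orthogonal matrix. [folklore] -/
private theorem frob_orthogonal_mul {φ : Matrix (Fin 8) (Fin 8) ℝ} (hφ : φ ∈ Matrix.orthogonalGroup (Fin 8) ℝ)
    (M : Matrix (Fin 8) (Fin 8) ℝ) : frob (φ * M) = frob M := by
  have hφt : φᵀ * φ = 1 := by
    have h := Matrix.mem_unitaryGroup_iff'.1 hφ
    rwa [Matrix.star_eq_conjTranspose, Matrix.conjTranspose_eq_transpose_of_trivial] at h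
  rw [frob_eq_trace, frob_eq_trace, Matrix.transpose_mul, Matrix.mul_assoc, ← Matrix.mul_assoc φᵀ, hφt,
    Matrix.one_mul]

/-- `frob` is continuous. [folklore] -/
private theorem continuous_frob : Continuous frob := by
  unfold frob
  fun_prop

variable (V : Fin r → SO8)

/-- The penalty `P(H, y) = Σ_k ‖H_k y − y V_k‖²_F`, `y ∈ SO(8)`. [folklore] -/
def penalty (H : Fin r → SO8) (y : SO8) : ℝ :=
  ∑ k, frob (((H k * y : SO8) : Matrix (Fin 8) (Fin 8) ℝ) - ((y * V k : SO8) : Matrix (Fin 8) (Fin 8) ℝ))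

/-- `0 ≤ P`. [folklore] -/
private theorem penalty_nonneg (H : Fin r → SO8) (y : SO8) : 0 ≤ penalty V H y :=
  Finset.sum_nonneg fun _ _ => frob_nonneg _

/-- `P` is jointly continuous in `(H, y)`. [folklore] -/
private theorem continuous_penalty : Continuous ↿(penalty V) := by
  change Continuous fun p : (Fin r → SO8) × SO8 => penalty V p.1 p.2
  unfold penalty
  refine continuous_finsetSum _ fun k _ => continuous_frob.comp ?_
  refine Continuous.sub ?_ ?_
  · exact continuous_subtype_val.comp (((continuous_apply k).comp continuous_fst).mul continuous_snd)
  · exact continuous_subtype_val.comp (continuous_snd.mul continuous_const)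

/-- `P(H, 1) = 0` at `H = V`. [folklore] -/
private theorem penalty_self_one : penalty V V 1 = 0 := by
  simp [penalty, frob]

/-- Conjugating all `H_k` by `c` is undone by `y ↦ c⁻¹ y`: `P(cHc⁻¹, y) = P(H, c⁻¹y)`. [folklore] -/
private theorem penalty_conj (H : Fin r → SO8) (c y : SO8) :
    penalty V (fun k => c * H k * c⁻¹) y = penalty V H (c⁻¹ * y) := by
  unfold penalty
  refine Finset.sum_congr rfl fun k _ => ?_
  have h1 : c * H k * c⁻¹ * y = c * (H k * (c⁻¹ * y)) := by group
  have h2 : y * V k = c * (c⁻¹ * y * V k) := by group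
  rw [h1, h2]
  simp only [Submonoid.coe_mul]
  rw [← Matrix.mul_sub, frob_orthogonal_mul (Matrix.mem_specialOrthogonalGroup_iff.1 c.2).1]

/-- **THE SEPARATING FUNCTION on `SO(8)^r`**: `sep(H) = min(1, inf_y P(H, y))`. [folklore] -/
def sep (H : Fin r → SO8) : ℝ := min 1 (⨅ y : SO8, penalty V H y)

/-- `0 ≤ sep ≤ 1`. [folklore] -/
private theorem sep_nonneg (H : Fin r → SO8) : 0 ≤ sep V H :=
  le_min zero_le_one (le_ciInf fun y => penalty_nonneg V H y)

/-- `sep ≤ 1`. [folklore] -/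
private theorem sep_le_one (H : Fin r → SO8) : sep V H ≤ 1 := min_le_left _ _

/-- `sep` is continuous (infimum of a jointly continuous function over the compact `SO(8)`). [folklore] -/
private theorem continuous_sep : Continuous (sep V) := by
  have h := isCompact_univ.continuous_sInf (f := penalty V) (continuous_penalty V)
  simp only [Set.image_univ, sInf_range] at h
  exact continuous_const.min h

/-- `sep` is invariant under simultaneous conjugation of the `H_k`. [folklore] -/
private theorem sep_conj (H : Fin r → SO8) (c : SO8) : sep V (fun k => c * H k * c⁻¹) = sep V H := by
  unfold sep
  congr 1
  simp_rw [penalty_conj]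
  exact (Equiv.mulLeft c⁻¹).iInf_comp (g := penalty V H)

/-- `sep(V) = 0`. [folklore] -/
private theorem sep_self : sep V V = 0 := by
  have hbdd : BddBelow (Set.range (penalty V V)) := ⟨0, by rintro _ ⟨y, rfl⟩; exact penalty_nonneg V V y⟩
  have h0 : (⨅ y : SO8, penalty V V y) = 0 :=
    le_antisymm ((ciInf_le hbdd 1).trans (penalty_self_one V).le) (le_ciInf fun y => penalty_nonneg V V y)
  unfold sep
  rw [h0, min_eq_right zero_le_one]

/-- **`sep(H) = 0` forces a simultaneous conjugator** (the infimum over the compact group is attained).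
[cite: Levy2004, Prop 3.5 (compactness argument)] -/
theorem exists_conj_of_sep_eq_zero {H : Fin r → SO8} (h : sep V H = 0) : ∃ y : SO8, ∀ k, H k = y * V k * y⁻¹ := by
  have hcont : Continuous (penalty V H) := by
    unfold penalty
    exact continuous_finsetSum _ fun k _ => continuous_frob.comp
      ((continuous_subtype_val.comp (continuous_const.mul continuous_id)).sub
        (continuous_subtype_val.comp (continuous_id.mul continuous_const)))
  have hinf : (⨅ y : SO8, penalty V H y) = 0 := by
    refine le_antisymm ?_ (le_ciInf fun y => penalty_nonneg V H y)
    have := min_le_iff.1 h.le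
    rcases this with h1 | h1
    · exact absurd h1 (by norm_num)
    · exact h1
  obtain ⟨y, hy⟩ : ∃ y : SO8, penalty V H y = ⨅ y : SO8, penalty V H y := by
    have hmem := (isCompact_range hcont).sInf_mem (Set.range_nonempty _)
    rw [sInf_range] at hmem
    exact hmem
  rw [hinf] at hy
  refine ⟨y, fun k => ?_⟩
  have hk := (Finset.sum_eq_zero_iff_of_nonneg fun k _ => frob_nonneg _).1 hy k (Finset.mem_univ _)
  have hmat := sub_eq_zero.1 (eq_zero_of_frob_eq_zero hk)
  have hgrp : H k * y = y * V k := Subtype.ext hmat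
  rw [← hgrp, mul_inv_cancel_right]

/-- **THE SEPARATING OBSERVABLE** `F(U) = sep((hol_{ℓ_k}(U))_k)`. [folklore] -/
def sepObs (d : ℕ) (U : LGConfig (d + 2) SO8) : ℝ := sep V fun k => walkHolonomy U (loopAt d k)

/-- The edge support: all edges under the loops `ℓ_k`, `k < r`. [folklore] -/
def sepSupport (d r : ℕ) : Finset (ZdEdge (d + 2)) :=
  Finset.univ.biUnion fun k : Fin r => ((loopAt d k).darts.map fun e => (dartStep e).1).toFinset

/-- `F` is a cylinder observable. [folklore] -/
private theorem isCylinder_sepObs : IsCylinder (sepObs V d) (sepSupport d r) := by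
  intro U U' hUU'
  unfold sepObs
  congr 1
  funext k
  refine walkHolonomy_congr _ fun e he => hUU' _ ?_
  simp only [sepSupport, Finset.coe_biUnion, Finset.coe_univ, Set.mem_univ, Set.iUnion_true, Set.mem_iUnion,
    List.coe_toFinset, Set.mem_setOf_eq, List.mem_map]
  exact ⟨k, e, he, rfl⟩

/-- `F` is continuous. [folklore] -/
private theorem continuous_sepObs : Continuous (sepObs V d) :=
  (continuous_sep V).comp (continuous_pi fun _ => continuous_walkHolonomy _)

/-- `|F| ≤ 1`. [folklore] -/
private theorem abs_sepObs_le (U : LGConfig (d + 2) SO8) : |sepObs V d U| ≤ 1 :=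
  abs_le.2 ⟨neg_one_lt_zero.le.trans (sep_nonneg V _), sep_le_one V _⟩

/-- **`F` is gauge invariant** (all `ℓ_k` are based at the origin; `sep` is conjugation invariant). [cite: Levy2004, §2 p.4] -/
theorem isZdGaugeInvariant_sepObs : IsZdGaugeInvariant (sepObs V d) := by
  intro g U
  unfold sepObs
  simp only [walkHolonomy_gaugeTransformZd]
  exact sep_conj V _ (g 0)

end Separating

/-! ## §5 Headline: no class of loop observables spans the gauge-invariant cylinders for `SO(8)` -/

section Headline

/-- **MODULE XIX's DENSITY SCHEMA FAILS FOR `SO(8)` EVEN FOR THE CLASS OF ALL CLASS-FUNCTION LOOP PRODUCTS**: for every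
`d`, the real span of `classLoopProducts (d+2) SO(8)` — all finite products of `U ↦ f(hol_ℓ(U))`, `f` any class
function, `ℓ` any based loop; in particular all Wilson loops of ALL finite-dimensional representations with their
products — is NOT sup-norm dense in the gauge-invariant continuous bounded cylinder observables of `ℤ^{d+2}`.
[cite: Levy2004, Thm 3.1 p.5 (SO(n) clause; refuted at n = 8); Sikora2017, Thm «undisting»] -/
theorem not_spansGaugeInvariantCylinders_classLoopProducts (d : ℕ) :
    ¬ SpansGaugeInvariantCylinders (d + 2) (classLoopProducts (d + 2) (Matrix.specialOrthogonalGroup (Fin 8) ℝ)) := by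
  obtain ⟨s, hs⟩ := exists_finset_not_simultaneous_conj
  set u : Fin s.card → U3 := fun k => (s.equivFin.symm k : U3) with hu
  set V : Fin s.card → SO8 := fun k => famV (u k) with hV
  have hVcfg : (fun k : Fin s.card => walkHolonomy (cfgOf (d := d) famV u) (loopAt d k)) = V :=
    funext fun k => walkHolonomy_loopAt famV_one u k
  have hWcfg : (fun k : Fin s.card => walkHolonomy (cfgOf (d := d) famW u) (loopAt d k)) = fun k => famW (u k) :=
    funext fun k => walkHolonomy_loopAt famW_one u k
  have hF0 : sepObs V d (cfgOf famV u) = 0 := by rw [sepObs, hVcfg]; exact sep_self V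
  have hF1 : sepObs V d (cfgOf famW u) ≠ 0 := fun h0 => by
    rw [sepObs, hWcfg] at h0
    obtain ⟨y, hy⟩ := exists_conj_of_sep_eq_zero V h0
    refine hs ⟨y, fun h hh => ?_⟩
    have := hy (s.equivFin ⟨h, hh⟩)
    simpa [hV, hu] using this
  refine not_spansGaugeInvariantCylinders_of_pointFunctional (P := Bool)
    (fun b => if b then cfgOf famV u else cfgOf famW u) (fun b => if b then 1 else -1) (fun W hW => ?_)
    (sepObs V d) (sepSupport d s.card) (isCylinder_sepObs V) (continuous_sepObs V) ⟨1, abs_sepObs_le V⟩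
    (isZdGaugeInvariant_sepObs V) ?_
  · simp only [pointFunctional, Fintype.sum_bool, if_true, Bool.false_eq_true, if_false, one_mul, neg_one_mul,
      eq_on_cfg hW u, add_neg_cancel]
  · simp only [pointFunctional, Fintype.sum_bool, if_true, Bool.false_eq_true, if_false, one_mul, neg_one_mul, hF0,
      zero_add, neg_ne_zero]
    exact hF1

/-- Hence NO SUB-CLASS spans either: any set of class-function loop products — e.g. the Wilson loops of any set of
representations, with products. [cite: Levy2004, Thm 3.1 p.5 (SO(n) clause; refuted at n = 8)] -/
theorem not_spansGaugeInvariantCylinders_of_subset_classLoopProducts (d : ℕ)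
    {𝒲 : Set (LGConfig (d + 2) (Matrix.specialOrthogonalGroup (Fin 8) ℝ) → ℝ)}
    (h𝒲 : 𝒲 ⊆ classLoopProducts (d + 2) (Matrix.specialOrthogonalGroup (Fin 8) ℝ)) :
    ¬ SpansGaugeInvariantCylinders (d + 2) 𝒲 := fun h =>
  not_spansGaugeInvariantCylinders_classLoopProducts d (spansGaugeInvariantCylinders_mono (Submodule.span_mono h𝒲) h)

/-- **In particular for EVERY SINGLE REPRESENTATION `ρ : SO(8) →* M_N(ℂ)`** (any `N`, continuity not needed):
`¬ SpansGaugeInvariantCylinders (d+2) (wilsonLoopProducts ρ (d+2))` — p348765 was the natural representation.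
[cite: Levy2004, Thm 3.1 p.5 and Abstract p.2; Sikora2017, Thm «undisting»] -/
theorem not_spansGaugeInvariantCylinders_wilsonLoopProducts_specialOrthogonalGroup_eight (d : ℕ) {N : ℕ}
    (ρ : Matrix.specialOrthogonalGroup (Fin 8) ℝ →* Matrix (Fin N) (Fin N) ℂ) :
    ¬ SpansGaugeInvariantCylinders (d + 2) (wilsonLoopProducts ρ (d + 2)) :=
  not_spansGaugeInvariantCylinders_of_subset_classLoopProducts d (wilsonLoopProducts_subset_classLoopProducts ρ)

end Headline

end Literature.MathematicalPhysics.QuantumFieldTheory.Balaban1983to89.ClassLoopObservablesNotDenseSO8
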